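import Literature.Barriers.ResolutionOfSingularities.ResidualOrderUnboundedBounds
import HarnessLib

/-!
# Hauser–Perlega's second example (odd characteristic): the stages of one cycle

`Literature/Barriers/ResolutionOfSingularities/ResidualOrderUnboundedExample2.lean` — the six
blow-up stages (1)–(6) of the SECOND EXAMPLE of Hauser–Perlega [cite: HauserPerlega2019, §4]
("Field of characteristic `p ≥ 3`, `n = 4`, `ord f = p³`", variables `x, y, v, w` = indices
`0, 1, 2, 3`), each as a theorem `Shape_before F → Shape_after (blowupStep P j t F)`, stated for an
abstract exponent `P` (`= p³`) and abstract raw exceptional exponents subject to explicitly listed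
arithmetic hypotheses; the arithmetic of the actual exponents (`a p³ + (p³−p²)/2`,
`b p³ − (p³−1)/2`, …, `q = (p+1)/2·(d + p² − 1)`, `m = 2d/(p−1) + p − 1`) is discharged in
`ResidualOrderUnboundedExample2Cycle.lean`.

## The printed cycle (TeX source of arXiv:1802.05010v1, §4), `d' = d + p(p−1)/2`

(0) `F = x^{ap³+(p³−p²)/2} y^{bp³−(p³−1)/2} v^{rp³} w^{sp³−d}·(y^{(p²−1)/2} w^d(λ + v^q Q) + x^{d+(p²+1)/2} v^q A)`,
residual order `(p²−1)/2 + d`;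
(1) `x`-chart, `y ↦ y+1`, `v ↦ v+1`, cleaning: `x^{ap³} w^{sp³−d}(y^{p²} w^d B + x^q w^d Q + x^{q+1} A)`;
(2) `(p−1)/2` times `x`-chart: `x^{ap³+(p³−p²)/2} w^{sp³−d}(y^{p²} w^d B + x^{d'+(p²+1)/2} A)`;
(3) `m` times `v`-chart: `… v^{rp³ + m(p³+p²−p+1)/2} …(y^{p²} v^{m(p−1)/2} w^d B + x^{d'+(p²+1)/2} A)`;
(4) `w`-chart, `v ↦ v+1`: `x^{…} w^{sp³−d'}(y^{p²} w^{d'} B + x^{d'+(p²+1)/2} A)`;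
(5) `y`-chart: `x^{…} y^{bp³−(p³−1)/2} w^{sp³−d'}(y^{(p²−1)/2} w^{d'} B + x^{d'+(p²+1)/2} A)`;
(6) `q'` times `v`-chart: the starting equation with `d'`, `q'` in place of `d`, `q`.

## Lean rendering

Three shapes suffice: `ShapeC d g j` (the starting equation (0), and the `v`-blow-ups (6) after
`j` of them), `Shape1'` (after (1)) and `ShapeB` (during (2), (3) and after (4)): each is a region
(finite union of orthants / exact points of exponent vectors in `ℕ⁴`, coordinates
`(e 0, e 1, e 2, e 3) = (x, y, v, w)`) containing the support, plus the non-vanishing of the two key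
coefficients. Blow-up (1) needs the Frobenius computation of the `λ`-term
(`blowupStep_monomial_pt_odd`, characteristic `p`); all other blow-ups are over any commutative ring.
-/

noncomputable section

open MvPolynomial Finset

open scoped BigOperators

namespace Literature.Barriers.ResolutionOfSingularities

open Literature.AlgebraicGeometry.Resolution.Hauser2010

namespace HauserPerlega

/-! ## Exponent vectors in the four variables `x, y, v, w` -/

section Exp4

/-- The exponent vector `(a, b, c, d)` of `xᵃ yᵇ vᶜ wᵈ`. [folklore] -/
def V4 (a b c d : ℕ) : Fin 4 →₀ ℕ :=
  Finsupp.equivFunOnFinite.symm ![a, b, c, d]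

/-- `x`-exponent of `V4 a b c d`. [folklore] -/
@[simp] theorem V4_apply_zero (a b c d : ℕ) : V4 a b c d 0 = a := rfl
/-- `y`-exponent of `V4 a b c d`. [folklore] -/
@[simp] theorem V4_apply_one (a b c d : ℕ) : V4 a b c d 1 = b := rfl
/-- `v`-exponent of `V4 a b c d`. [folklore] -/
@[simp] theorem V4_apply_two (a b c d : ℕ) : V4 a b c d 2 = c := rfl
/-- `w`-exponent of `V4 a b c d`. [folklore] -/
@[simp] theorem V4_apply_three (a b c d : ℕ) : V4 a b c d 3 = d := rfl

/-- `∀` over `Fin 4`. [folklore] -/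
theorem forall_fin4 {P : Fin 4 → Prop} : (∀ i, P i) ↔ P 0 ∧ P 1 ∧ P 2 ∧ P 3 := by
  constructor
  · intro h; exact ⟨h 0, h 1, h 2, h 3⟩
  · rintro ⟨h0, h1, h2, h3⟩ i
    fin_cases i <;> assumption

/-- Equality of exponent vectors is coordinatewise. [folklore] -/
theorem eq_V4_iff (f : Fin 4 →₀ ℕ) (a b c d : ℕ) :
    f = V4 a b c d ↔ f 0 = a ∧ f 1 = b ∧ f 2 = c ∧ f 3 = d := by
  rw [Finsupp.ext_iff, forall_fin4]
  simp

/-- The degree in coordinates. [folklore] -/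
theorem degree_fin4 (f : Fin 4 →₀ ℕ) : f.degree = f 0 + f 1 + f 2 + f 3 := by
  rw [Finsupp.degree_eq_sum, Fin.sum_univ_four]

/-- Total degree of `V4 a b c d`. [folklore] -/
@[simp] theorem degree_V4 (a b c d : ℕ) : (V4 a b c d).degree = a + b + c + d := by
  rw [degree_fin4]; rfl

/-- `q`-th power exponents in coordinates. [folklore] -/
theorem isPthPowerExponent_fin4_iff (q : ℕ) (f : Fin 4 →₀ ℕ) :
    IsPthPowerExponent q f ↔ q ∣ f 0 ∧ q ∣ f 1 ∧ q ∣ f 2 ∧ q ∣ f 3 := by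
  rw [isPthPowerExponent_iff, forall_fin4]

/-- Pointwise order in coordinates. [folklore] -/
theorem V4_le_iff (a b c d : ℕ) (f : Fin 4 →₀ ℕ) :
    V4 a b c d ≤ f ↔ a ≤ f 0 ∧ b ≤ f 1 ∧ c ≤ f 2 ∧ d ≤ f 3 := by
  rw [Finsupp.le_def, forall_fin4]
  simp

end Exp4

/-! ## The charts of the second example and their `Produces` / `base` -/

section Charts4

variable {K : Type*} [CommRing K]

/-- Translation vector of a chart: `tᵢ = 1` on `T`, `0` elsewhere. [cite: HauserPerlega2019, §2] -/
def tOf4 (T : Finset (Fin 4)) : Fin 4 → K := fun i => if i ∈ T then 1 else 0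

/-- The hypothesis `ht` of the toolkit for the chart `(j, T)`: `tᵢ = 0` off `T`. [folklore] -/
theorem tOf4_hyp (T : Finset (Fin 4)) (j : Fin 4) :
    ∀ i, i ∉ T → i ≠ j → (tOf4 T i : K) = 0 := fun i hi _ => by simp [tOf4, hi]

/-- On `T` the translation is `1`, so `∏_{i∈T} tᵢ^{nᵢ} = 1`. [folklore] -/
theorem prod_tOf4_pow (T : Finset (Fin 4)) (n : Fin 4 → ℕ) :
    ∏ i ∈ T, (tOf4 T i : K) ^ (n i) = 1 :=
  Finset.prod_eq_one fun i hi => by simp [tOf4, hi]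

variable (P : ℕ)

/-- `x`-chart (monomial). [folklore] -/
theorem produces4_x_iff (e e' : Fin 4 →₀ ℕ) : Produces P 0 ∅ e e' ↔
    e.degree = e' 0 + P ∧ e' 1 = e 1 ∧ e' 2 = e 2 ∧ e' 3 = e 3 := by
  simp [Produces, forall_fin4]

/-- `base` for the `x`-chart in coordinates. [folklore] -/
theorem base4_x (e : Fin 4 →₀ ℕ) : base P 0 ∅ e = V4 (e.degree - P) (e 1) (e 2) (e 3) := by
  rw [eq_V4_iff]; simp [base_apply]

/-- `x`-chart with `y ↦ y + 1`, `v ↦ v + 1`. [folklore] -/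
theorem produces4_xyv_iff (e e' : Fin 4 →₀ ℕ) : Produces P 0 {1, 2} e e' ↔
    e.degree = e' 0 + P ∧ e' 3 = e 3 := by
  simp [Produces, forall_fin4]

/-- `base` for the `x`-chart with `y, v` translated, in coordinates. [folklore] -/
theorem base4_xyv (e : Fin 4 →₀ ℕ) : base P 0 {1, 2} e = V4 (e.degree - P) 0 0 (e 3) := by
  rw [eq_V4_iff]; simp [base_apply]

/-- `y`-chart. [folklore] -/
theorem produces4_y_iff (e e' : Fin 4 →₀ ℕ) : Produces P 1 ∅ e e' ↔
    e.degree = e' 1 + P ∧ e' 0 = e 0 ∧ e' 2 = e 2 ∧ e' 3 = e 3 := by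
  simp [Produces, forall_fin4]

/-- `base` for the `y`-chart in coordinates. [folklore] -/
theorem base4_y (e : Fin 4 →₀ ℕ) : base P 1 ∅ e = V4 (e 0) (e.degree - P) (e 2) (e 3) := by
  rw [eq_V4_iff]; simp [base_apply]

/-- `v`-chart. [folklore] -/
theorem produces4_v_iff (e e' : Fin 4 →₀ ℕ) : Produces P 2 ∅ e e' ↔
    e.degree = e' 2 + P ∧ e' 0 = e 0 ∧ e' 1 = e 1 ∧ e' 3 = e 3 := by
  simp [Produces, forall_fin4]

/-- `base` for the `v`-chart in coordinates. [folklore] -/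
theorem base4_v (e : Fin 4 →₀ ℕ) : base P 2 ∅ e = V4 (e 0) (e 1) (e.degree - P) (e 3) := by
  rw [eq_V4_iff]; simp [base_apply]

/-- `w`-chart with `v ↦ v + 1`. [folklore] -/
theorem produces4_wv_iff (e e' : Fin 4 →₀ ℕ) : Produces P 3 {2} e e' ↔
    e.degree = e' 3 + P ∧ e' 0 = e 0 ∧ e' 1 = e 1 := by
  simp [Produces, forall_fin4]

/-- `base` for the `w`-chart with `v` translated, in coordinates. [folklore] -/
theorem base4_wv (e : Fin 4 →₀ ℕ) : base P 3 {2} e = V4 (e 0) (e 1) 0 (e.degree - P) := by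
  rw [eq_V4_iff]; simp [base_apply]

end Charts4

/-! ## The shapes -/

section Shapes

variable {K : Type*} [CommRing K]

/-- Shape (0) = shape during the `v`-blow-ups (6) after `j` of them (`(0)` of the next cycle is
`j = q'`): `x^{ex} y^{ey} v^{ev} w^{ew}·(y^g w^d(λ + H) + x^{d+g+1} v^j A)` with every monomial of
`H` divisible by `v^j` and by one of `x, y, w` (`g ↔ (p²−1)/2`, `ex ↔ ap³ + (p³−p²)/2`,
`ey ↔ bp³ − (p³−1)/2`, `ev ↔ rp³`, `ew ↔ sp³ − d`): the exact point `λ·M y^g w^d`, the part of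
`y^g w^d H·M` and the orthant of `x^{d+g+1} v^j A·M`. [cite: HauserPerlega2019, §4 Second example (0), (6)] -/
def ShapeC (d g j ex ey ev ew : ℕ) (F : MvPolynomial (Fin 4) K) : Prop :=
  (∀ e ∈ F.support, e = V4 ex (ey + g) ev (ew + d) ∨
      (ex ≤ e 0 ∧ ey + g ≤ e 1 ∧ ev + j ≤ e 2 ∧ ew + d ≤ e 3 ∧
        ex + (ey + g) + (ew + d) + 1 ≤ e 0 + e 1 + e 3) ∨
      (ex + d + g + 1 ≤ e 0 ∧ ey ≤ e 1 ∧ ev + j ≤ e 2 ∧ ew ≤ e 3)) ∧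
  coeff (V4 ex (ey + g) ev (ew + d)) F ≠ 0 ∧ coeff (V4 (ex + d + g + 1) ey (ev + j) ew) F ≠ 0

/-- Shape after blow-up (1): `x^{ex} w^{ew}·(y^{p²} w^d B + x^q w^d Q + x^{q+1} A)` (`ex ↔ ap³`,
`p2 ↔ p²`, `qv ↔ q`). [cite: HauserPerlega2019, §4 Second example (1)] -/
def Shape1' (d p2 qv ex ew : ℕ) (F : MvPolynomial (Fin 4) K) : Prop :=
  (∀ e ∈ F.support, (ex ≤ e 0 ∧ p2 ≤ e 1 ∧ ew + d ≤ e 3) ∨ (ex + qv ≤ e 0 ∧ ew + d ≤ e 3) ∨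
      (ex + qv + 1 ≤ e 0 ∧ ew ≤ e 3)) ∧
  coeff (V4 ex p2 0 (ew + d)) F ≠ 0 ∧ coeff (V4 (ex + qv + 1) 0 0 ew) F ≠ 0

/-- Shape during the `x`-blow-ups (2), the `v`-blow-ups (3) and after (4):
`x^{ex} v^{ev} w^{ew}·(y^{p²} v^{vB − ev} w^d B + x^{xa} A)`. [cite: HauserPerlega2019, §4 Second example (2)–(4)] -/
def ShapeB (d p2 ex ev vB ew xa : ℕ) (F : MvPolynomial (Fin 4) K) : Prop :=
  (∀ e ∈ F.support, (ex ≤ e 0 ∧ p2 ≤ e 1 ∧ vB ≤ e 2 ∧ ew + d ≤ e 3) ∨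
      (ex + xa ≤ e 0 ∧ ev ≤ e 2 ∧ ew ≤ e 3)) ∧
  coeff (V4 ex p2 vB (ew + d)) F ≠ 0 ∧ coeff (V4 (ex + xa) 0 ev ew) F ≠ 0

end Shapes

/-! ## The monomial blow-ups (2)–(6) -/

section Stages

variable {K : Type*} [CommRing K] {P : ℕ}

/-- **First blow-up of (2)**, `x`-chart: `S1 → SB` with `xa = q + 1 − p² − d` (the `Q`-part is
absorbed into `x^{xa} A`). [cite: HauserPerlega2019, §4 Second example (2)] -/
theorem shapeB_of_shape1' {d p2 qv ex ew ex' xa : ℕ} (hd : 1 ≤ d) (hp2 : 0 < p2) (hp2P : p2 < P)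
    (hex' : ex' + P = ex + p2 + ew + d) (hxa : xa + p2 + d = qv + 1)
    (hA : P ∣ ex' + xa → P ∣ ew → False)
    {F : MvPolynomial (Fin 4) K} (hF : Shape1' d p2 qv ex ew F) :
    ShapeB d p2 ex' 0 0 ew xa (blowupStep P 0 (tOf4 ∅) F) := by
  obtain ⟨hR, hk1, hk2⟩ := hF
  have hq : ∀ e ∈ F.support, P ≤ e.degree := fun e he => by
    have h := hR e he; rw [degree_fin4]; omega
  have hj : (0 : Fin 4) ∉ (∅ : Finset (Fin 4)) := by simp
  refine ⟨?_, ?_, ?_⟩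
  · intro e' he'
    obtain ⟨-, e, he, hp⟩ := exists_produces_of_mem_support_blowupStep hj (tOf4_hyp ∅ 0) hq he'
    have h := hR e he
    rw [produces4_x_iff, degree_fin4] at hp
    omega
  · have hb : V4 ex' p2 0 (ew + d) = base P 0 ∅ (V4 ex p2 0 (ew + d)) := by
      rw [base4_x, degree_V4, eq_V4_iff]; simp; omega
    rw [hb, coeff_base_blowupStep hj (tOf4_hyp ∅ 0) hq (by simp; omega) ?_ ?_, prod_tOf4_pow, mul_one]
    · simpa using hk1
    · intro e he hp
      have h := hR e he
      rw [← hb, produces4_x_iff, degree_fin4] at hp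
      rw [eq_V4_iff]
      simp only [V4_apply_zero, V4_apply_one, V4_apply_two, V4_apply_three] at hp
      omega
    · rw [← hb, isPthPowerExponent_fin4_iff]
      simp only [V4_apply_zero, V4_apply_one, V4_apply_two, V4_apply_three]
      rintro ⟨-, h1, -, -⟩
      exact absurd (Nat.le_of_dvd hp2 h1) (by omega)
  · have hb : V4 (ex' + xa) 0 0 ew = base P 0 ∅ (V4 (ex + qv + 1) 0 0 ew) := by
      rw [base4_x, degree_V4, eq_V4_iff]; simp; omega
    rw [hb, coeff_base_blowupStep hj (tOf4_hyp ∅ 0) hq (by simp; omega) ?_ ?_, prod_tOf4_pow, mul_one]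
    · simpa using hk2
    · intro e he hp
      have h := hR e he
      rw [← hb, produces4_x_iff, degree_fin4] at hp
      rw [eq_V4_iff]
      simp only [V4_apply_zero, V4_apply_one, V4_apply_two, V4_apply_three] at hp
      omega
    · rw [← hb, isPthPowerExponent_fin4_iff]
      simp only [V4_apply_zero, V4_apply_one, V4_apply_two, V4_apply_three]
      rintro ⟨h0, -, -, h3⟩
      exact hA h0 h3

/-- **Further blow-ups of (2)**, `x`-chart, while `y^{p²} w^d B` is the term of least degree
(`p² + vB + d ≤ xa + ev`): `SB(ex, xa) → SB(ex', xa')`. [cite: HauserPerlega2019, §4 Second example (2)] -/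
theorem shapeB_xstep {d p2 ex ev vB ew xa ex' xa' : ℕ} (hp2 : 0 < p2) (hp2P : p2 < P)
    (hP : P ≤ ex + p2 + vB + ew + d)
    (hex' : ex' + P = ex + p2 + vB + ew + d) (hxa' : xa' + p2 + vB + d = xa + ev)
    (hA : P ∣ ex' + xa' → P ∣ ev → P ∣ ew → False)
    {F : MvPolynomial (Fin 4) K} (hF : ShapeB d p2 ex ev vB ew xa F) :
    ShapeB d p2 ex' ev vB ew xa' (blowupStep P 0 (tOf4 ∅) F) := by
  obtain ⟨hR, hk1, hk2⟩ := hF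
  have hq : ∀ e ∈ F.support, P ≤ e.degree := fun e he => by
    have h := hR e he; rw [degree_fin4]; omega
  have hj : (0 : Fin 4) ∉ (∅ : Finset (Fin 4)) := by simp
  refine ⟨?_, ?_, ?_⟩
  · intro e' he'
    obtain ⟨-, e, he, hp⟩ := exists_produces_of_mem_support_blowupStep hj (tOf4_hyp ∅ 0) hq he'
    have h := hR e he
    rw [produces4_x_iff, degree_fin4] at hp
    omega
  · have hb : V4 ex' p2 vB (ew + d) = base P 0 ∅ (V4 ex p2 vB (ew + d)) := by
      rw [base4_x, degree_V4, eq_V4_iff]; simp; omega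
    rw [hb, coeff_base_blowupStep hj (tOf4_hyp ∅ 0) hq (by simp; omega) ?_ ?_, prod_tOf4_pow, mul_one]
    · simpa using hk1
    · intro e he hp
      have h := hR e he
      rw [← hb, produces4_x_iff, degree_fin4] at hp
      rw [eq_V4_iff]
      simp only [V4_apply_zero, V4_apply_one, V4_apply_two, V4_apply_three] at hp
      omega
    · rw [← hb, isPthPowerExponent_fin4_iff]
      simp only [V4_apply_zero, V4_apply_one, V4_apply_two, V4_apply_three]
      rintro ⟨-, h1, -, -⟩
      exact absurd (Nat.le_of_dvd hp2 h1) (by omega)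
  · have hb : V4 (ex' + xa') 0 ev ew = base P 0 ∅ (V4 (ex + xa) 0 ev ew) := by
      rw [base4_x, degree_V4, eq_V4_iff]; simp; omega
    rw [hb, coeff_base_blowupStep hj (tOf4_hyp ∅ 0) hq (by simp; omega) ?_ ?_, prod_tOf4_pow, mul_one]
    · simpa using hk2
    · intro e he hp
      have h := hR e he
      rw [← hb, produces4_x_iff, degree_fin4] at hp
      rw [eq_V4_iff]
      simp only [V4_apply_zero, V4_apply_one, V4_apply_two, V4_apply_three] at hp
      omega
    · rw [← hb, isPthPowerExponent_fin4_iff]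
      simp only [V4_apply_zero, V4_apply_one, V4_apply_two, V4_apply_three]
      rintro ⟨h0, -, h2, h3⟩
      exact hA h0 h2 h3

/-- **Blow-ups (3)**, `v`-chart, while `x^{xa} A` is the term of least degree (`xa + ev ≤ p² + vB + d`):
the exceptional `v`-exponent grows by `|x^{xa}A·M| − p³`, the `v`-exponent of `y^{p²}…B` by the
difference of degrees. [cite: HauserPerlega2019, §4 Second example (3)] -/
theorem shapeB_vstep {d p2 ex ev vB ew xa ev' vB' : ℕ} (hp2 : 0 < p2) (hp2P : p2 < P) (hxa : 1 ≤ xa)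
    (hP : P ≤ ex + xa + ev + ew)
    (hev' : ev' + P = ex + xa + ev + ew) (hvB' : vB' + P = ex + p2 + vB + ew + d)
    (hA : P ∣ ex + xa → P ∣ ev' → P ∣ ew → False)
    {F : MvPolynomial (Fin 4) K} (hF : ShapeB d p2 ex ev vB ew xa F) :
    ShapeB d p2 ex ev' vB' ew xa (blowupStep P 2 (tOf4 ∅) F) := by
  obtain ⟨hR, hk1, hk2⟩ := hF
  have hq : ∀ e ∈ F.support, P ≤ e.degree := fun e he => by
    have h := hR e he; rw [degree_fin4]; omega
  have hj : (2 : Fin 4) ∉ (∅ : Finset (Fin 4)) := by simp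
  refine ⟨?_, ?_, ?_⟩
  · intro e' he'
    obtain ⟨-, e, he, hp⟩ := exists_produces_of_mem_support_blowupStep hj (tOf4_hyp ∅ 2) hq he'
    have h := hR e he
    rw [produces4_v_iff, degree_fin4] at hp
    omega
  · have hb : V4 ex p2 vB' (ew + d) = base P 2 ∅ (V4 ex p2 vB (ew + d)) := by
      rw [base4_v, degree_V4, eq_V4_iff]; simp; omega
    rw [hb, coeff_base_blowupStep hj (tOf4_hyp ∅ 2) hq (by simp; omega) ?_ ?_, prod_tOf4_pow, mul_one]
    · simpa using hk1
    · intro e he hp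
      have h := hR e he
      rw [← hb, produces4_v_iff, degree_fin4] at hp
      rw [eq_V4_iff]
      simp only [V4_apply_zero, V4_apply_one, V4_apply_two, V4_apply_three] at hp
      omega
    · rw [← hb, isPthPowerExponent_fin4_iff]
      simp only [V4_apply_zero, V4_apply_one, V4_apply_two, V4_apply_three]
      rintro ⟨-, h1, -, -⟩
      exact absurd (Nat.le_of_dvd hp2 h1) (by omega)
  · have hb : V4 (ex + xa) 0 ev' ew = base P 2 ∅ (V4 (ex + xa) 0 ev ew) := by
      rw [base4_v, degree_V4, eq_V4_iff]; simp; omega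
    rw [hb, coeff_base_blowupStep hj (tOf4_hyp ∅ 2) hq (by simp; omega) ?_ ?_, prod_tOf4_pow, mul_one]
    · simpa using hk2
    · intro e he hp
      have h := hR e he
      rw [← hb, produces4_v_iff, degree_fin4] at hp
      rw [eq_V4_iff]
      simp only [V4_apply_zero, V4_apply_one, V4_apply_two, V4_apply_three] at hp
      omega
    · rw [← hb, isPthPowerExponent_fin4_iff]
      simp only [V4_apply_zero, V4_apply_one, V4_apply_two, V4_apply_three]
      rintro ⟨h0, -, h2, h3⟩
      exact hA h0 h2 h3

/-- **Blow-up (4)**, `w`-chart with `v ↦ v + 1` (the unit `(v+1)^{…}` is absorbed into `A`, `B`):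
`SB(d; ex, ev, vB, ew, xa) → SB(d₂; ex, 0, 0, ew', xa)` with `ew' = |x^{xa}A·M| − p³` and
`d₂ = (p² + vB + d) − (xa + ev)` (`= d'`). [cite: HauserPerlega2019, §4 Second example (4)] -/
theorem shapeB_wstep {d p2 ex ev vB ew xa ew' d₂ : ℕ} (hp2 : 0 < p2) (hp2P : p2 < P) (hxa : 1 ≤ xa)
    (hP : P ≤ ex + xa + ev + ew)
    (hew' : ew' + P = ex + xa + ev + ew) (hd₂ : d₂ + xa + ev = p2 + vB + d)
    (hA : P ∣ ex + xa → P ∣ ew' → False)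
    {F : MvPolynomial (Fin 4) K} (hF : ShapeB d p2 ex ev vB ew xa F) :
    ShapeB d₂ p2 ex 0 0 ew' xa (blowupStep P 3 (tOf4 {2}) F) := by
  obtain ⟨hR, hk1, hk2⟩ := hF
  have hq : ∀ e ∈ F.support, P ≤ e.degree := fun e he => by
    have h := hR e he; rw [degree_fin4]; omega
  have hj : (3 : Fin 4) ∉ ({2} : Finset (Fin 4)) := by decide
  refine ⟨?_, ?_, ?_⟩
  · intro e' he'
    obtain ⟨-, e, he, hp⟩ := exists_produces_of_mem_support_blowupStep hj (tOf4_hyp {2} 3) hq he'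
    have h := hR e he
    rw [produces4_wv_iff, degree_fin4] at hp
    omega
  · have hb : V4 ex p2 0 (ew' + d₂) = base P 3 {2} (V4 ex p2 vB (ew + d)) := by
      rw [base4_wv, degree_V4, eq_V4_iff]; simp; omega
    rw [hb, coeff_base_blowupStep hj (tOf4_hyp {2} 3) hq (by simp; omega) ?_ ?_, prod_tOf4_pow,
      mul_one]
    · simpa using hk1
    · intro e he hp
      have h := hR e he
      rw [← hb, produces4_wv_iff, degree_fin4] at hp
      rw [eq_V4_iff]
      simp only [V4_apply_zero, V4_apply_one, V4_apply_three] at hp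
      omega
    · rw [← hb, isPthPowerExponent_fin4_iff]
      simp only [V4_apply_zero, V4_apply_one, V4_apply_two, V4_apply_three]
      rintro ⟨-, h1, -, -⟩
      exact absurd (Nat.le_of_dvd hp2 h1) (by omega)
  · have hb : V4 (ex + xa) 0 0 ew' = base P 3 {2} (V4 (ex + xa) 0 ev ew) := by
      rw [base4_wv, degree_V4, eq_V4_iff]; simp; omega
    rw [hb, coeff_base_blowupStep hj (tOf4_hyp {2} 3) hq (by simp; omega) ?_ ?_, prod_tOf4_pow,
      mul_one]
    · simpa using hk2
    · intro e he hp
      have h := hR e he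
      rw [← hb, produces4_wv_iff, degree_fin4] at hp
      rw [eq_V4_iff]
      simp only [V4_apply_zero, V4_apply_one, V4_apply_three] at hp
      omega
    · rw [← hb, isPthPowerExponent_fin4_iff]
      simp only [V4_apply_zero, V4_apply_one, V4_apply_two, V4_apply_three]
      rintro ⟨h0, -, -, h3⟩
      exact hA h0 h3

/-- **Blow-up (5)**, `y`-chart: `SB(d'; ex, 0, 0, ew, xa) → SC(d', g, 0; ex, ey', 0, ew)` where
`xa = d' + g + 1`, `p² = 2g + 1` and `ey' = |x^{xa}A·M| − p³`: "`w^{d'} y^{(p²−1)/2}` becomes the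
new initial form". [cite: HauserPerlega2019, §4 Second example (5)] -/
theorem shapeC_of_shapeB {d p2 g ex ew xa ey' : ℕ} (hd : 1 ≤ d) (hg : p2 = 2 * g + 1)
    (hxa : xa = d + g + 1) (hP : P ≤ ex + xa + ew) (hey' : ey' + P = ex + xa + ew)
    (hB : ¬ P ∣ ey' + g) (hA : ¬ P ∣ ey')
    {F : MvPolynomial (Fin 4) K} (hF : ShapeB d p2 ex 0 0 ew xa F) :
    ShapeC d g 0 ex ey' 0 ew (blowupStep P 1 (tOf4 ∅) F) := by
  obtain ⟨hR, hk1, hk2⟩ := hF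
  have hq : ∀ e ∈ F.support, P ≤ e.degree := fun e he => by
    have h := hR e he; rw [degree_fin4]; omega
  have hj : (1 : Fin 4) ∉ (∅ : Finset (Fin 4)) := by simp
  refine ⟨?_, ?_, ?_⟩
  · intro e' he'
    obtain ⟨-, e, he, hp⟩ := exists_produces_of_mem_support_blowupStep hj (tOf4_hyp ∅ 1) hq he'
    have h := hR e he
    rw [produces4_y_iff, degree_fin4] at hp
    rw [eq_V4_iff]
    omega
  · have hb : V4 ex (ey' + g) 0 (ew + d) = base P 1 ∅ (V4 ex p2 0 (ew + d)) := by
      rw [base4_y, degree_V4, eq_V4_iff]; simp; omega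
    rw [hb, coeff_base_blowupStep hj (tOf4_hyp ∅ 1) hq (by simp; omega) ?_ ?_, prod_tOf4_pow, mul_one]
    · simpa using hk1
    · intro e he hp
      have h := hR e he
      rw [← hb, produces4_y_iff, degree_fin4] at hp
      rw [eq_V4_iff]
      simp only [V4_apply_zero, V4_apply_one, V4_apply_two, V4_apply_three] at hp
      omega
    · rw [← hb, isPthPowerExponent_fin4_iff]
      simp only [V4_apply_zero, V4_apply_one, V4_apply_two, V4_apply_three]
      rintro ⟨-, h1, -, -⟩
      exact hB h1
  · have hb : V4 (ex + d + g + 1) ey' (0 + 0) ew = base P 1 ∅ (V4 (ex + xa) 0 0 ew) := by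
      rw [base4_y, degree_V4, eq_V4_iff]; simp; omega
    rw [hb, coeff_base_blowupStep hj (tOf4_hyp ∅ 1) hq (by simp; omega) ?_ ?_, prod_tOf4_pow, mul_one]
    · simpa using hk2
    · intro e he hp
      have h := hR e he
      rw [← hb, produces4_y_iff, degree_fin4] at hp
      rw [eq_V4_iff]
      simp only [V4_apply_zero, V4_apply_one, V4_apply_two, V4_apply_three] at hp
      omega
    · rw [← hb, isPthPowerExponent_fin4_iff]
      simp only [V4_apply_zero, V4_apply_one, V4_apply_two, V4_apply_three]
      rintro ⟨-, h1, -, -⟩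
      exact hA h1

/-- **Blow-ups (6)**, `v`-chart, one at a time: `SC(j) → SC(j+1)`, the exceptional `v`-exponent
growing by `|λ·M y^g w^d| − p³`; every monomial of `H` gains at least one `v`.
[cite: HauserPerlega2019, §4 Second example (6)] -/
theorem shapeC_vstep {d g j ex ey ev ew ev' : ℕ} (hd : 1 ≤ d)
    (hP : P ≤ ex + (ey + g) + ev + (ew + d)) (hev' : ev' + P = ex + (ey + g) + ev + (ew + d))
    (hB : ¬ P ∣ ey + g) (hA : ¬ P ∣ ey)
    {F : MvPolynomial (Fin 4) K} (hF : ShapeC d g j ex ey ev ew F) :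
    ShapeC d g (j + 1) ex ey ev' ew (blowupStep P 2 (tOf4 ∅) F) := by
  obtain ⟨hR, hk1, hk2⟩ := hF
  have hq : ∀ e ∈ F.support, P ≤ e.degree := fun e he => by
    have h := hR e he; rw [eq_V4_iff] at h; rw [degree_fin4]; omega
  have hj : (2 : Fin 4) ∉ (∅ : Finset (Fin 4)) := by simp
  refine ⟨?_, ?_, ?_⟩
  · intro e' he'
    obtain ⟨-, e, he, hp⟩ := exists_produces_of_mem_support_blowupStep hj (tOf4_hyp ∅ 2) hq he'
    have h := hR e he
    rw [produces4_v_iff, degree_fin4] at hp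
    rw [eq_V4_iff] at h ⊢
    omega
  · have hb : V4 ex (ey + g) ev' (ew + d) = base P 2 ∅ (V4 ex (ey + g) ev (ew + d)) := by
      rw [base4_v, degree_V4, eq_V4_iff]; simp; omega
    rw [hb, coeff_base_blowupStep hj (tOf4_hyp ∅ 2) hq (by simp; omega) ?_ ?_, prod_tOf4_pow, mul_one]
    · simpa using hk1
    · intro e he hp
      have h := hR e he
      rw [← hb, produces4_v_iff, degree_fin4] at hp
      rw [eq_V4_iff] at h ⊢
      simp only [V4_apply_zero, V4_apply_one, V4_apply_two, V4_apply_three] at hp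
      omega
    · rw [← hb, isPthPowerExponent_fin4_iff]
      simp only [V4_apply_zero, V4_apply_one, V4_apply_two, V4_apply_three]
      rintro ⟨-, h1, -, -⟩
      exact hB h1
  · have hb : V4 (ex + d + g + 1) ey (ev' + (j + 1)) ew =
        base P 2 ∅ (V4 (ex + d + g + 1) ey (ev + j) ew) := by
      rw [base4_v, degree_V4, eq_V4_iff]; simp; omega
    rw [hb, coeff_base_blowupStep hj (tOf4_hyp ∅ 2) hq (by simp; omega) ?_ ?_, prod_tOf4_pow, mul_one]
    · simpa using hk2
    · intro e he hp
      have h := hR e he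
      rw [← hb, produces4_v_iff, degree_fin4] at hp
      rw [eq_V4_iff] at h ⊢
      simp only [V4_apply_zero, V4_apply_one, V4_apply_two, V4_apply_three] at hp
      omega
    · rw [← hb, isPthPowerExponent_fin4_iff]
      simp only [V4_apply_zero, V4_apply_one, V4_apply_two, V4_apply_three]
      rintro ⟨-, h1, -, -⟩
      exact hA h1

/-! ## Blow-up (1): the `x`-chart with `y ↦ y + 1`, `v ↦ v + 1`, and the cleaning -/

/-- **The `λ`-term under blow-up (1)** (characteristic `p`): the transform of
`λ · x^a y^{p²N} v^{p³r} w^{w}` (`p ∤ N`, `p³ ∣ w`, total degree `p³(k+1)`) in the `x`-chart with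
`y ↦ y+1`, `v ↦ v+1` is `λ x^{p³k} w^{w} (y^{p²}+1)^N (v^{p³}+1)^r`; cleaning deletes exactly the
terms `C(N,i) y^{p² i}` with `p ∣ i` — among them "`λ w^d (v+1)^{rp³}`" (`i = 0`) — and keeps
"`y^{p²} w^d · B`": all surviving monomials have `y`-exponent `≥ p²`, and `x^{p³k} y^{p²} w^{w}` has
coefficient `λ N ≠ 0`. [cite: HauserPerlega2019, §4 Second example (1)] -/
theorem blowupStep_monomial_pt_odd {p : ℕ} [hp : Fact p.Prime] [CharP K p] [IsDomain K]
    {a N v3 w k : ℕ} (hN : ¬ p ∣ N) (hw : p ^ 3 ∣ w)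
    (hdeg : a + p ^ 2 * N + p ^ 3 * v3 + w = p ^ 3 * (k + 1)) {cc : K} (hcc : cc ≠ 0) :
    (∀ e' ∈ (blowupStep (p ^ 3) 0 (tOf4 {1, 2}) (monomial (V4 a (p ^ 2 * N) (p ^ 3 * v3) w) cc)).support,
        e' 0 = p ^ 3 * k ∧ p ^ 2 ≤ e' 1 ∧ e' 3 = w) ∧
      coeff (V4 (p ^ 3 * k) (p ^ 2) 0 w)
        (blowupStep (p ^ 3) 0 (tOf4 {1, 2}) (monomial (V4 a (p ^ 2 * N) (p ^ 3 * v3) w) cc)) ≠ 0 := by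
  have hp1 : 1 < p := hp.out.one_lt
  have hp0 : 0 < p := by omega
  have hj : (0 : Fin 4) ∉ ({1, 2} : Finset (Fin 4)) := by decide
  set pt : Fin 4 →₀ ℕ := V4 a (p ^ 2 * N) (p ^ 3 * v3) w with hpt
  have hdeg' : p ^ 3 ≤ pt.degree := by
    rw [hpt, degree_V4, hdeg]; exact Nat.le_mul_of_pos_right _ (Nat.succ_pos k)
  have hbase : base (p ^ 3) 0 {1, 2} pt = V4 (p ^ 3 * k) 0 0 w := by
    rw [base4_xyv, hpt, degree_V4, eq_V4_iff]
    simp only [V4_apply_zero, V4_apply_one, V4_apply_two, V4_apply_three, hdeg]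
    refine ⟨?_, trivial, trivial, trivial⟩
    rw [Nat.mul_succ, Nat.add_sub_cancel]
  set W : MvPolynomial (Fin 4) K := (X 2 ^ p ^ 3 + C 1) ^ v3 with hW
  have hWq : IsQthPowerSupported (p ^ 3) W := isQthPowerSupported_X_pow_add_C_pow _ 2 1 _
  have hWvars : W.vars ⊆ {2} := (vars_pow _ _).trans (vars_X_pow_add_C_subset 2 _ 1)
  have hWconst : constantCoeff W = 1 := by rw [hW]; simp [constantCoeff_X, hp0.ne']
  -- the monomials `U i · y^{p² i}` of the transform
  set U : ℕ → MvPolynomial (Fin 4) K :=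
    fun i => monomial (V4 (p ^ 3 * k) 0 0 w) (cc * (N.choose i : K)) * W with hU
  have hUq : ∀ i, IsQthPowerSupported (p ^ 3) (U i) := by
    intro i
    refine (isQthPowerSupported_monomial ?_ _).mul hWq
    rw [isPthPowerExponent_fin4_iff]
    simp only [V4_apply_zero, V4_apply_one, V4_apply_two, V4_apply_three]
    exact ⟨dvd_mul_right _ _, dvd_zero _, dvd_zero _, hw⟩
  have htrans : transformResidual (p ^ 3) 0 (tOf4 {1, 2}) (monomial pt cc) =
      ∑ i ∈ Finset.range (N + 1), U i * monomial (Finsupp.single 1 (p ^ 2 * i)) 1 := by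
    rw [transformResidual_monomial hj (tOf4_hyp {1, 2} 0) hdeg', hbase]
    have htF : transFactor {1, 2} (tOf4 {1, 2}) pt = (X 1 ^ p ^ 2 + 1) ^ N * W := by
      unfold transFactor
      rw [Finset.prod_pair (by decide : (1 : Fin 4) ≠ 2)]
      simp only [tOf4, Finset.mem_insert, Finset.mem_singleton, true_or, or_true, if_true, hpt,
        V4_apply_one, V4_apply_two]
      rw [X_add_C_pow_mul, one_pow, X_add_C_pow_mul, one_pow, hW, C_1]
    rw [htF, add_pow, Finset.sum_mul, Finset.mul_sum]
    refine Finset.sum_congr rfl fun i _ => ?_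
    rw [one_pow, mul_one, ← pow_mul, X_pow_eq_monomial,
      ← map_natCast (C : K →+* MvPolynomial (Fin 4) K) (N.choose i), hU]
    simp only
    rw [show monomial (V4 (p ^ 3 * k) 0 0 w) (cc * (N.choose i : K)) =
        monomial (V4 (p ^ 3 * k) 0 0 w) cc * C (N.choose i : K) by
      rw [mul_comm (monomial _ _) (C _), C_mul_monomial, mul_comm cc]]
    ring
  have hstep : blowupStep (p ^ 3) 0 (tOf4 {1, 2}) (monomial pt cc) =
      ∑ i ∈ (Finset.range (N + 1)).filter (fun i => ¬ p ∣ i),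
        U i * monomial (Finsupp.single 1 (p ^ 2 * i)) 1 := by
    rw [blowupStep, htrans, deletePthPowers_sum, Finset.sum_filter]
    refine Finset.sum_congr rfl fun i _ => ?_
    by_cases hpi : p ∣ i
    · rw [if_neg (not_not.mpr hpi)]
      refine ((hUq i).mul (isQthPowerSupported_monomial ?_ 1)).deletePthPowers_eq_zero
      rw [isPthPowerExponent_iff]
      intro l
      rw [Finsupp.single_apply]
      split_ifs
      · obtain ⟨m, rfl⟩ := hpi
        exact ⟨m, by ring⟩
      · exact dvd_zero _
    · rw [if_pos hpi]
      refine (hUq i).deletePthPowers_mul_monomial ?_ 1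
      rw [isPthPowerExponent_iff]
      intro h
      have h1 := h 1
      rw [Finsupp.single_eq_same, pow_succ, mul_comm (p ^ 2) p] at h1
      exact hpi (Nat.dvd_of_mul_dvd_mul_right (pow_pos hp0 2) (by simpa [mul_comm] using h1))
  rw [hstep]
  constructor
  · intro e' he'
    obtain ⟨i, hi, he'i⟩ := Finset.mem_biUnion.mp (support_sum he')
    rw [Finset.mem_filter, Finset.mem_range] at hi
    obtain ⟨a', ha', rfl⟩ := exists_add_of_mem_support_mul_monomial he'i
    rw [hU] at ha'
    simp only at ha'
    rw [MvPolynomial.mem_support_iff, coeff_monomial_mul'] at ha'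
    split_ifs at ha' with hle
    · have hmem : a' - V4 (p ^ 3 * k) 0 0 w ∈ W.support := by
        rw [MvPolynomial.mem_support_iff]; intro h0; exact ha' (by rw [h0, mul_zero])
      have hq0 : (a' - V4 (p ^ 3 * k) 0 0 w) 0 = 0 := apply_eq_zero_of_not_mem_vars hmem (fun h => by
        have := hWvars h; simp at this)
      have hq1 : (a' - V4 (p ^ 3 * k) 0 0 w) 1 = 0 := apply_eq_zero_of_not_mem_vars hmem (fun h => by
        have := hWvars h; simp at this)
      have hq3 : (a' - V4 (p ^ 3 * k) 0 0 w) 3 = 0 := apply_eq_zero_of_not_mem_vars hmem (fun h => by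
        have := hWvars h; simp at this)
      rw [V4_le_iff] at hle
      simp only [Finsupp.tsub_apply, V4_apply_zero, V4_apply_one, V4_apply_three] at hq0 hq1 hq3
      have hs0 : (Finsupp.single (1 : Fin 4) (p ^ 2 * i)) 0 = 0 := by
        rw [Finsupp.single_apply, if_neg (by decide)]
      have hs1 : (Finsupp.single (1 : Fin 4) (p ^ 2 * i)) 1 = p ^ 2 * i := Finsupp.single_eq_same
      have hs3 : (Finsupp.single (1 : Fin 4) (p ^ 2 * i)) 3 = 0 := by
        rw [Finsupp.single_apply, if_neg (by decide)]
      simp only [Finsupp.add_apply, hs0, hs1, hs3, add_zero]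
      have hi0 : i ≠ 0 := fun h => hi.2 (h ▸ dvd_zero p)
      refine ⟨by omega, ?_, by omega⟩
      have : p ^ 2 * 1 ≤ p ^ 2 * i := Nat.mul_le_mul_left _ (Nat.one_le_iff_ne_zero.mpr hi0)
      omega
    · exact absurd rfl ha'
  · have hN0 : N ≠ 0 := fun h => hN (h ▸ dvd_zero p)
    have h1mem : 1 ∈ (Finset.range (N + 1)).filter (fun i => ¬ p ∣ i) := by
      rw [Finset.mem_filter, Finset.mem_range]
      exact ⟨by omega, fun h => absurd (Nat.le_of_dvd one_pos h) (by omega)⟩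
    rw [coeff_sum, Finset.sum_eq_single_of_mem 1 h1mem]
    · have hV : V4 (p ^ 3 * k) (p ^ 2) 0 w = V4 (p ^ 3 * k) 0 0 w + Finsupp.single 1 (p ^ 2 * 1) := by
        rw [Finsupp.ext_iff, forall_fin4]; simp
      rw [hV, coeff_mul_monomial, mul_one, hU]
      simp only
      rw [coeff_monomial_mul', if_pos le_rfl, tsub_self, ← constantCoeff_eq, hWconst, mul_one,
        Nat.choose_one_right]
      refine mul_ne_zero hcc ?_
      rw [Ne, CharP.cast_eq_zero_iff K p]
      exact hN
    · intro i hi hi1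
      rw [Finset.mem_filter, Finset.mem_range] at hi
      rw [coeff_mul_monomial']
      rw [if_neg]
      intro hle
      have := hle 1
      simp only [Finsupp.single_eq_same, V4_apply_one] at this
      have hi0 : i ≠ 0 := fun h => hi.2 (h ▸ dvd_zero p)
      have h2 : 2 ≤ i := by omega
      have : p ^ 2 * 2 ≤ p ^ 2 * i := Nat.mul_le_mul_left _ h2
      have hp2 : 0 < p ^ 2 := pow_pos hp0 2
      omega

/-- **Blow-up (1)**, `x`-chart with `y ↦ y + 1`, `v ↦ v + 1`, followed by the cleaning:
`SC(d, g, q; ex, ey, ev, ew) → S1(d, p², q; p³k, ew)` when `ey + g = p²N` (`p ∤ N`), `ev = p³r`,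
`p³ ∣ ew + d` and `|λ·M y^g w^d| = p³(k+1)`; "the residual order has increased by `(p²+1)/2`".
Valid over every integral domain of characteristic `p`. [cite: HauserPerlega2019, §4 Second example (1)] -/
theorem shape1'_of_shapeC {p : ℕ} [hp : Fact p.Prime] [CharP K p] [IsDomain K]
    {d g qv ex ey ev ew N v3 k : ℕ} (hd : 1 ≤ d) (hqv : 1 ≤ qv)
    (hN : ey + g = p ^ 2 * N) (hpN : ¬ p ∣ N) (hv : ev = p ^ 3 * v3) (hw : p ^ 3 ∣ ew + d)
    (hdeg : ex + (ey + g) + ev + (ew + d) = p ^ 3 * (k + 1))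
    (hA : p ^ 3 ∣ p ^ 3 * k + qv + 1 → p ^ 3 ∣ ew → False)
    {F : MvPolynomial (Fin 4) K} (hF : ShapeC d g qv ex ey ev ew F) :
    Shape1' d (p ^ 2) qv (p ^ 3 * k) ew (blowupStep (p ^ 3) 0 (tOf4 {1, 2}) F) := by
  obtain ⟨hR, hk1, hk2⟩ := hF
  have hp1 : 1 < p := hp.out.one_lt
  have hp2pos : 0 < p ^ 2 := pow_pos (by omega) 2
  have hp3 : p ^ 2 < p ^ 3 := Nat.pow_lt_pow_right hp1 (by norm_num)
  have hk : p ^ 3 * (k + 1) = p ^ 3 * k + p ^ 3 := by ring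
  have hj : (0 : Fin 4) ∉ ({1, 2} : Finset (Fin 4)) := by decide
  set p₀ : Fin 4 →₀ ℕ := V4 ex (ey + g) ev (ew + d) with hp₀
  set c₀ : K := coeff p₀ F with hc₀
  set F' : MvPolynomial (Fin 4) K := F - monomial p₀ c₀ with hF'
  have hcoeffF' : ∀ e, coeff e F' = if e = p₀ then 0 else coeff e F := by
    intro e
    rw [hF', coeff_sub, coeff_monomial]
    by_cases h : e = p₀
    · subst h; simp [hc₀]
    · rw [if_neg (Ne.symm h), if_neg h, sub_zero]
  have hsuppF' : ∀ e ∈ F'.support, e ≠ p₀ ∧ e ∈ F.support := by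
    intro e he
    rw [MvPolynomial.mem_support_iff, hcoeffF'] at he
    split_ifs at he with h
    · exact absurd rfl he
    · exact ⟨h, MvPolynomial.mem_support_iff.mpr he⟩
  have hR' : ∀ e ∈ F'.support,
      (ex ≤ e 0 ∧ ey + g ≤ e 1 ∧ ev + qv ≤ e 2 ∧ ew + d ≤ e 3 ∧
        ex + (ey + g) + (ew + d) + 1 ≤ e 0 + e 1 + e 3) ∨
      (ex + d + g + 1 ≤ e 0 ∧ ey ≤ e 1 ∧ ev + qv ≤ e 2 ∧ ew ≤ e 3) := by
    intro e he
    obtain ⟨hne, heF⟩ := hsuppF' e he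
    rcases hR e heF with h | h | h
    · exact absurd h hne
    · exact Or.inl h
    · exact Or.inr h
  have hq' : ∀ e ∈ F'.support, p ^ 3 ≤ e.degree := fun e he => by
    have h := hR' e he; rw [degree_fin4]; omega
  have hdecomp : F = F' + monomial p₀ c₀ := by rw [hF', sub_add_cancel]
  have hpt : p₀ = V4 ex (p ^ 2 * N) (p ^ 3 * v3) (ew + d) := by rw [hp₀, hN, hv]
  obtain ⟨hxs, hxc⟩ := blowupStep_monomial_pt_odd (K := K) (a := ex) (k := k) hpN hw
    (by rw [← hN, ← hv]; exact hdeg) hk1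
  rw [← hpt] at hxs hxc
  rw [hdecomp, blowupStep_add]
  refine ⟨?_, ?_, ?_⟩
  · intro e' he'
    rcases Finset.mem_union.mp (support_add he') with h | h
    · obtain ⟨-, e, he, hpr⟩ := exists_produces_of_mem_support_blowupStep hj (tOf4_hyp {1, 2} 0) hq' h
      have hh := hR' e he
      rw [produces4_xyv_iff, degree_fin4] at hpr
      omega
    · have := hxs e' h
      omega
  · rw [coeff_add, coeff_blowupStep_eq_zero hj (tOf4_hyp {1, 2} 0) hq', zero_add]
    · exact hxc
    · intro e he hpr
      have hh := hR' e he
      rw [produces4_xyv_iff, degree_fin4] at hpr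
      simp only [V4_apply_zero, V4_apply_three] at hpr
      omega
  · have hb : V4 (p ^ 3 * k + qv + 1) 0 0 ew =
        base (p ^ 3) 0 {1, 2} (V4 (ex + d + g + 1) ey (ev + qv) ew) := by
      rw [base4_xyv, degree_V4, eq_V4_iff]; simp; omega
    rw [coeff_add, hb, coeff_base_blowupStep hj (tOf4_hyp {1, 2} 0) hq' (by simp; omega) ?_ ?_,
      prod_tOf4_pow, mul_one]
    · have h0 : coeff (base (p ^ 3) 0 {1, 2} (V4 (ex + d + g + 1) ey (ev + qv) ew))
          (blowupStep (p ^ 3) 0 (tOf4 {1, 2}) (monomial p₀ c₀)) = 0 := by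
        by_contra hne
        have := hxs _ (MvPolynomial.mem_support_iff.mpr hne)
        rw [← hb] at this
        simp only [V4_apply_zero, V4_apply_one, V4_apply_three] at this
        omega
      rw [h0, add_zero, hcoeffF', if_neg]
      · exact hk2
      · intro h
        rw [hp₀, eq_V4_iff] at h
        simp only [V4_apply_zero, V4_apply_one, V4_apply_two, V4_apply_three] at h
        omega
    · intro e he hpr
      have hh := hR' e he
      rw [← hb, produces4_xyv_iff, degree_fin4] at hpr
      rw [eq_V4_iff]
      simp only [V4_apply_zero, V4_apply_three] at hpr
      omega
    · rw [← hb, isPthPowerExponent_fin4_iff]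
      simp only [V4_apply_zero, V4_apply_one, V4_apply_two, V4_apply_three]
      rintro ⟨h0, -, -, h3⟩
      exact hA h0 h3

end Stages

end HauserPerlega

end Literature.Barriers.ResolutionOfSingularities
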